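import Mathlib
import Summits.MatrixMultiplication.MatrixMultiplication.Theses.FidelityWitnesses
import Summits.MatrixMultiplication.MatrixMultiplication.Theorems.FidelityWitnessesFidelityGapTwoSixConeClosure
import Literature.Computability.AlgebraicComplexity.AsymptoticRankZariskiClosedProofs
import Literature.Computability.AlgebraicComplexity.BorderRankLimit
import Literature.Computability.AlgebraicComplexity.AlderStrassenProofs
import Literature.Computability.AlgebraicComplexity.SchoenhageTauBini
import Literature.Computability.AlgebraicComplexity.FlatteningBound
import Literature.Computability.AlgebraicComplexity.BigCwFourthOmega
import Literature.Computability.AlgebraicComplexity.CoppersmithWinograd1982Crude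
import Literature.Computability.AlgebraicComplexity.AsymptoticRankConjecture
import Literature.Computability.AlgebraicComplexity.AsymptoticRankMatMul
import Literature.Computability.AlgebraicComplexity.TensorRestrictionRank
import Literature.Barriers.MatrixMultiplication.UniversalMethodBarrierAsymptoticRank
import Literature.Computability.AlgebraicComplexity.MatrixMultiplicationExponentInf

/-!
# Disproof of `FidelityThesis` — findings (standing adversary, crux stmt-MatrixMultiplication-4956)

The crux (route `MatrixMultiplication/FidelityWitnesses`, rank 0 = the route TARGET):

  `∃ δ > 0, ∃ c > 0, ∀ n ≥ 1, ∀ r ≤ c·n^{2+δ}, ∃ ε > 0, ∀ S (R(S) ≤ r),`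
  `‖Σ S·⟨n,n,n⟩‖² ≤ (1 − ε)·n³·Σ‖S‖²`

("a fidelity gap along a superquadratic curve").

## Findings (index)

* §0 `GapAt n r ε`, `FidelityGap n r`, `FidelityThesisAt δ` — the crux as `∃ δ > 0, FidelityThesisAt δ`
  (`crux_iff`, `Iff.rfl`).
* §1 REDUCTION for every `n ≥ 1` (sorry-free, tree theorems only: cone criterion
  `Theorems.stub_coneClosure` + Alder's theorem): `FidelityGap n r ↔ ⟨n,n,n⟩ ∉ closure{R ≤ r} ↔
  r < R̲(⟨n,n,n⟩)` (`fidelityGap_iff_lt_algBorderRank`).  `n = 0` is vacuous (`fidelityGap_zero_left`).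
* §2 THE CRUX IS EXACTLY `ω(ℂ) > 2`, kernel-checked in BOTH directions:
  `crux_iff_two_lt_omega : FidelityThesis ↔ 2 < ω(ℂ)` and
  `not_crux_iff_statement : ¬ FidelityThesis ↔ MatrixMultiplication` (`ω(ℂ) = 2`, the summit).
  **A disproof of this crux is a proof of the summit, nothing less** — there is no cheap kill, no
  degenerate instance, no small model: every attack below only narrows the admissible `(δ, c)`.
* §2c REGISTERED CONJECTURES THAT KILL IT: the asymptotic rank conjecture (`BCS1997_problem155_negative ℂ`,
  BCS Problem 15.5 / CGLVW Q1.7) gives `ω(ℂ) ≤ 2` (`omega_le_two_of_asymptoticRankConjecture`, via `⟨2,2,2⟩`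
  as a `4×4×4` tensor) hence `¬ FidelityThesis` (`crux_false_of_asymptoticRankConjecture`).
* §2b THE EXPONENT WINDOW: `FidelityThesisAt δ → 2 + δ ≤ ω(ℂ)` and `2 + δ < ω(ℂ) → FidelityThesisAt δ`,
  so `sup {δ | FidelityThesisAt δ} = ω(ℂ) − 2`; with the tree's `ω ≤ 2.37295` (Le Gall CW⁴,
  `LeGall2014_cw4_omega_le`, sorry-free): **`¬ FidelityThesisAt δ` for every `δ > 0.37295`**
  (`not_fidelityThesisAt_of_gt`), in particular `δ = 1/2`, `δ = 1`; the family is antitone in `δ`.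
* §2d WHAT ANY PROOF MUST DELIVER: `R̲(⟨n,n,n⟩) > A·n²` eventually, for every `A`
  (`eventually_lt_algBorderRank_of_fidelityThesisAt`), in particular beyond the cactus cap `6n² − 4` of all
  linear rank methods (`eventually_cactusCap_lt_algBorderRank_of_crux`).
* §3 LOAD-BEARING ANALYSIS: dropping `tensorRank S ≤ r` — FALSE (`crux_false_without_rankBound`,
  witness `S = ⟨1,1,1⟩`); dropping `r ≤ c·n^{2+δ}` — FALSE (`crux_false_without_growthBound`, `(n,r) =
  (1,1)`); `c ≥ 1` — FALSE for every `δ` (`not_fidelityThesisAt_with_one_le`, `(n,r) = (1,1)`: any witness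
  has `c < 1`); `1 ≤ n` — NOT load-bearing (`cruxWithoutOneLeN_iff_crux`); `0 < δ` — carries ALL the
  content: `FidelityThesisAt 0` is a THEOREM (`fidelityThesisAt_zero`, flattening `n² ≤ R̲(⟨n,n,n⟩)`).
* §4 TIGHTNESS of `ε` at each `(n, r)`: `ε ≤ 1 − r/n³` (`gapAt_eps_le`, partial standard algorithm).
* §5 WHY IT RESISTS / numerics pointers (docstring at the end).
-/

set_option linter.dupNamespace false

namespace Summit.MatrixMultiplication.MatrixMultiplication.Cruxes.FidelityThesis.Disproof

open scoped BigOperators ComplexConjugate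
open Filter
open Literature.Computability.AlgebraicComplexity
open Literature.Barriers.MatrixMultiplication (asymptoticRank_le_of_polyDegeneratesTo)
open Summit.MatrixMultiplication.MatrixMultiplication.Theses.FidelityWitnesses (FidelityThesis)

/-! ## §0 The family -/

/-- The format of `n × n` matrix multiplication tensors over `ℂ`. -/
abbrev Tn (n : ℕ) : Type := Fin n × Fin n → Fin n × Fin n → Fin n × Fin n → ℂ

/-- The fidelity-gap inequality at `(n, r)` with constant `ε`. -/
def GapAt (n r : ℕ) (ε : ℝ) : Prop :=
  ∀ S : Tn n, tensorRank S ≤ r →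
    ‖∑ a, ∑ b, ∑ c, S a b c * matMulTensor ℂ n n n a b c‖ ^ 2 ≤
      (1 - ε) * (n : ℝ) ^ 3 * ∑ a, ∑ b, ∑ c, ‖S a b c‖ ^ 2

/-- A fidelity gap at `(n, r)`: some `ε > 0` works. -/
def FidelityGap (n r : ℕ) : Prop := ∃ ε : ℝ, 0 < ε ∧ GapAt n r ε

/-- The crux at a FIXED exponent `2 + δ`: gaps all along the curve `r ≤ c·n^{2+δ}`. -/
def FidelityThesisAt (δ : ℝ) : Prop :=
  ∃ c : ℝ, 0 < c ∧ ∀ n r : ℕ, 1 ≤ n → (r : ℝ) ≤ c * (n : ℝ) ^ (2 + δ) → FidelityGap n r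

/-- The crux is `∃ δ > 0, FidelityThesisAt δ` (definitionally). -/
theorem crux_iff : FidelityThesis ↔ ∃ δ : ℝ, 0 < δ ∧ FidelityThesisAt δ := Iff.rfl

/-- More triads allowed ⇒ harder to have a gap. -/
theorem fidelityGap_antitone {n r r' : ℕ} (h : r ≤ r') : FidelityGap n r' → FidelityGap n r := by
  rintro ⟨ε, hε, hgap⟩
  exact ⟨ε, hε, fun S hS => hgap S (hS.trans h)⟩

/-! ## Auxiliary sums for `⟨n,n,n⟩` -/

/-- `Σ_{abc} ⟨n,n,n⟩_{abc} = n³` (the tensor has `n³` ones). -/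
theorem sum_matMulTensor (K : Type) [CommRing K] (n : ℕ) :
    (∑ a : Fin n × Fin n, ∑ b : Fin n × Fin n, ∑ c : Fin n × Fin n,
      matMulTensor K n n n a b c) = (n : K) ^ 3 := by
  have h1 : ∀ a b : Fin n × Fin n,
      (∑ c : Fin n × Fin n, matMulTensor K n n n a b c) = if a.1 = b.1 then 1 else 0 := by
    intro a b
    by_cases hab : a.1 = b.1
    · rw [if_pos hab, Finset.sum_eq_single (b.2, a.2)]
      · simp [matMulTensor, hab]
      · intro c _ hc
        simp only [matMulTensor]
        rw [if_neg]
        rintro ⟨-, h2, h3⟩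
        exact hc (Prod.ext h2.symm h3.symm)
      · intro h
        exact absurd (Finset.mem_univ _) h
    · rw [if_neg hab]
      exact Finset.sum_eq_zero fun c _ => by
        simp [matMulTensor, hab]
  have h2 : ∀ a : Fin n × Fin n, (∑ b : Fin n × Fin n, if a.1 = b.1 then (1 : K) else 0) = n := by
    intro a
    rw [Fintype.sum_prod_type, Finset.sum_comm]
    simp
  simp_rw [h1, h2]
  simp [Finset.sum_const, Finset.card_univ, Fintype.card_prod, Fintype.card_fin]
  ring

/-- The entries of `⟨n,n,n⟩` are idempotent (`0/1`). -/
theorem matMulTensor_mul_self {n : ℕ} (a b c : Fin n × Fin n) :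
    matMulTensor ℂ n n n a b c * matMulTensor ℂ n n n a b c = matMulTensor ℂ n n n a b c := by
  simp only [matMulTensor]
  split_ifs <;> simp

/-- `‖⟨n,n,n⟩_{abc}‖² = ⟨n,n,n⟩_{abc}` read in `ℝ`. -/
theorem norm_sq_matMulTensor {n : ℕ} (a b c : Fin n × Fin n) :
    ‖matMulTensor ℂ n n n a b c‖ ^ 2 = matMulTensor ℝ n n n a b c := by
  simp only [matMulTensor]
  split_ifs <;> simp

/-- `‖⟨n,n,n⟩‖² = n³`. -/
theorem normSq_matMulTensor (n : ℕ) :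
    (∑ a : Fin n × Fin n, ∑ b : Fin n × Fin n, ∑ c : Fin n × Fin n,
      ‖matMulTensor ℂ n n n a b c‖ ^ 2) = (n : ℝ) ^ 3 := by
  simp_rw [norm_sq_matMulTensor]
  exact sum_matMulTensor ℝ n

/-- The self-overlap `Σ ⟨n,n,n⟩·⟨n,n,n⟩ = n³` (complex). -/
theorem overlap_self (n : ℕ) :
    (∑ a : Fin n × Fin n, ∑ b : Fin n × Fin n, ∑ c : Fin n × Fin n,
      matMulTensor ℂ n n n a b c * matMulTensor ℂ n n n a b c) = (n : ℂ) ^ 3 := by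
  simp_rw [matMulTensor_mul_self]
  exact sum_matMulTensor ℂ n

/-- `‖(n : ℂ)³‖² = n⁶`. -/
theorem norm_sq_natCast_cube (n : ℕ) : ‖((n : ℂ)) ^ 3‖ ^ 2 = ((n : ℝ) ^ 3) * ((n : ℝ) ^ 3) := by
  rw [norm_pow, Complex.norm_natCast]
  ring

/-- Conjugation fixes the real tensor `⟨n,n,n⟩`. -/
theorem conj_matMulTensor {n : ℕ} (a b c : Fin n × Fin n) :
    (starRingEnd ℂ) (matMulTensor ℂ n n n a b c) = matMulTensor ℂ n n n a b c := by
  unfold matMulTensor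
  split_ifs <;> simp

/-- Sesquilinear and bilinear overlaps with `⟨n,n,n⟩` have the same norm. -/
theorem norm_overlap_conj {n : ℕ} (S : Tn n) :
    ‖∑ a, ∑ b, ∑ c, (starRingEnd ℂ) (S a b c) * matMulTensor ℂ n n n a b c‖ =
      ‖∑ a, ∑ b, ∑ c, S a b c * matMulTensor ℂ n n n a b c‖ := by
  have h : (∑ a, ∑ b, ∑ c, (starRingEnd ℂ) (S a b c) * matMulTensor ℂ n n n a b c)
      = (starRingEnd ℂ) (∑ a, ∑ b, ∑ c, S a b c * matMulTensor ℂ n n n a b c) := by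
    simp only [map_sum, map_mul, conj_matMulTensor]
  rw [h, Complex.norm_conj]

/-- `⟨n,n,n⟩` itself violates every gap inequality with `ε > 0` (for `n ≥ 1`). -/
theorem not_gap_self {n : ℕ} (hn : 1 ≤ n) {ε : ℝ} (hε : 0 < ε) :
    ¬ ‖∑ a, ∑ b, ∑ c, matMulTensor ℂ n n n a b c * matMulTensor ℂ n n n a b c‖ ^ 2 ≤
      (1 - ε) * (n : ℝ) ^ 3 * ∑ a, ∑ b, ∑ c, ‖matMulTensor ℂ n n n a b c‖ ^ 2 := by
  rw [overlap_self, normSq_matMulTensor, norm_sq_natCast_cube]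
  have hpos : (0 : ℝ) < (n : ℝ) ^ 3 * (n : ℝ) ^ 3 := by positivity
  intro h
  nlinarith

/-- A tensor of rank `0` over a finite format is `0`. -/
theorem eq_zero_of_tensorRank_eq_zero {n : ℕ} (S : Tn n) (h : tensorRank S = 0) : S = 0 := by
  obtain ⟨w, u, v, hS⟩ := exists_triad_decomposition_tensorRank S
  haveI : IsEmpty (Fin (tensorRank S)) := h ▸ Fin.isEmpty'
  calc S = ∑ i, triad (w i) (u i) (v i) := hS
    _ = 0 := Fintype.sum_empty _

/-- The rung `r = 0` is free: only `S = 0` has rank `0`. -/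
theorem fidelityGap_rank_zero (n : ℕ) : FidelityGap n 0 := by
  refine ⟨1 / 2, by norm_num, fun S hS => ?_⟩
  have h0 : S = 0 := eq_zero_of_tensorRank_eq_zero S (Nat.le_zero.1 hS)
  subst h0
  simp

/-- `n = 0` is vacuous: all sums are empty. -/
theorem fidelityGap_zero_left (r : ℕ) : FidelityGap 0 r :=
  ⟨1 / 2, by norm_num, fun S _ => by simp⟩

/-! ## §1 Reduction: a gap at `(n, r)` is exactly `r < R̲(⟨n,n,n⟩)` -/

/-- **Easy half of the witness theorem (continuity)**: if `⟨n,n,n⟩` is a limit of rank-`≤ r` tensors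
there is no fidelity gap at `(n, r)` (`n ≥ 1`). -/
theorem not_fidelityGap_of_mem_closure {n r : ℕ} (hn : 1 ≤ n)
    (h : matMulTensor ℂ n n n ∈ closure {S : Tn n | tensorRank S ≤ r}) : ¬ FidelityGap n r := by
  rintro ⟨ε, hε, hgap⟩
  set f : Tn n → ℝ := fun S =>
    ‖∑ a, ∑ b, ∑ c, S a b c * matMulTensor ℂ n n n a b c‖ ^ 2 -
      (1 - ε) * (n : ℝ) ^ 3 * ∑ a, ∑ b, ∑ c, ‖S a b c‖ ^ 2 with hf
  have hcont : Continuous f := by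
    simp only [hf]
    fun_prop
  have hopen : IsOpen (f ⁻¹' Set.Ioi 0) := hcont.isOpen_preimage _ isOpen_Ioi
  have hT : matMulTensor ℂ n n n ∈ f ⁻¹' Set.Ioi 0 := by
    simp only [Set.mem_preimage, Set.mem_Ioi, hf, overlap_self, normSq_matMulTensor,
      norm_sq_natCast_cube]
    have hpos : (0 : ℝ) < (n : ℝ) ^ 3 * (n : ℝ) ^ 3 := by positivity
    nlinarith
  obtain ⟨S, hSU, hSC⟩ := mem_closure_iff.1 h _ hopen hT
  have h1 := hgap S hSC
  simp only [Set.mem_preimage, Set.mem_Ioi, hf] at hSU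
  linarith

/-- **Hard half (cone criterion, tree theorem `Theorems.stub_coneClosure`)**: if `⟨n,n,n⟩` is not a
limit of rank-`≤ r` tensors, a uniform gap exists (all `n`). -/
theorem fidelityGap_of_notMem_closure {n r : ℕ}
    (h : matMulTensor ℂ n n n ∉ closure {S : Tn n | tensorRank S ≤ r}) : FidelityGap n r := by
  by_contra hgap
  refine h (Theorems.stub_coneClosure _ (fun c S hS => ?_) _ fun ε hε => ?_)
  · show tensorRank (c • S) ≤ r
    exact (tensorRank_smul_le c S).trans hS
  · unfold FidelityGap GapAt at hgap
    push Not at hgap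
    obtain ⟨S, hS, hlt⟩ := hgap ε hε
    refine ⟨S, hS, ?_⟩
    rw [norm_overlap_conj, normSq_matMulTensor]
    have hcomm : (1 - ε) * (∑ a, ∑ b, ∑ c, ‖S a b c‖ ^ 2) * (n : ℝ) ^ 3
        = (1 - ε) * (n : ℝ) ^ 3 * ∑ a, ∑ b, ∑ c, ‖S a b c‖ ^ 2 := by ring
    rw [hcomm]
    exact hlt

/-- **Witness theorem for `⟨n,n,n⟩`** (`n ≥ 1`): gap at `(n, r)` iff `⟨n,n,n⟩ ∉ closure {rank ≤ r}`. -/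
theorem fidelityGap_iff_notMem_closure {n : ℕ} (hn : 1 ≤ n) (r : ℕ) :
    FidelityGap n r ↔ matMulTensor ℂ n n n ∉ closure {S : Tn n | tensorRank S ≤ r} :=
  ⟨fun h hmem => not_fidelityGap_of_mem_closure hn hmem h, fidelityGap_of_notMem_closure⟩

/-- **Border-rank form** (Alder's theorem, proved in the tree): gap at `(n, r)` iff
`r < R̲(⟨n,n,n⟩)`. -/
theorem fidelityGap_iff_lt_algBorderRank {n : ℕ} (hn : 1 ≤ n) (r : ℕ) :
    FidelityGap n r ↔ r < algBorderRank (matMulTensor ℂ n n n) := by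
  rw [fidelityGap_iff_notMem_closure hn,
    mem_closure_setOf_tensorRank_le_iff alder_secantVariety_eq_setOf_algBorderRank_le_holds, not_le]

/-- **Fact-light kill switch at a rung**: `R̲(⟨n,n,n⟩) ≤ r → ¬ FidelityGap n r` (continuity +
`{R̲ ≤ r} ⊆ closure {R ≤ r}` only). -/
theorem not_fidelityGap_of_algBorderRank_le {n r : ℕ} (hn : 1 ≤ n)
    (h : algBorderRank (matMulTensor ℂ n n n) ≤ r) : ¬ FidelityGap n r :=
  not_fidelityGap_of_mem_closure hn (mem_closure_setOf_tensorRank_le_of_algBorderRank_le h)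

/-- Honest rank suffices to kill a rung: `R(⟨n,n,n⟩) ≤ r → ¬ FidelityGap n r` (`S = ⟨n,n,n⟩`). -/
theorem not_fidelityGap_of_tensorRank_le {n r : ℕ} (hn : 1 ≤ n)
    (h : tensorRank (matMulTensor ℂ n n n) ≤ r) : ¬ FidelityGap n r := by
  rintro ⟨ε, hε, hgap⟩
  exact not_gap_self hn hε (hgap _ h)

/-- In particular no rung `r ≥ n³` has a gap. -/
theorem not_fidelityGap_cube {n r : ℕ} (hn : 1 ≤ n) (h : n ^ 3 ≤ r) : ¬ FidelityGap n r :=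
  not_fidelityGap_of_tensorRank_le hn ((tensorRank_matMulTensor_le ℂ n n n).trans (by
    simpa [pow_succ, mul_assoc] using h))

/-! ## §2 The crux is exactly `ω(ℂ) > 2` -/

/-- A witness at exponent `2 + δ` forces the superquadratic RANK lower bound
`c·n^{2+δ} ≤ R(⟨n,n,n⟩)` for all `n ≥ 1` (apply the gap at `r = R(⟨n,n,n⟩)` to `S = ⟨n,n,n⟩`). -/
theorem rank_lower_of_fidelityThesisAt {δ : ℝ} (h : FidelityThesisAt δ) :
    ∃ c : ℝ, 0 < c ∧ ∀ n : ℕ, 1 ≤ n →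
      c * (n : ℝ) ^ (2 + δ) ≤ (tensorRank (matMulTensor ℂ n n n) : ℝ) := by
  obtain ⟨c, hc, hgap⟩ := h
  refine ⟨c, hc, fun n hn => ?_⟩
  by_contra hlt
  rw [not_le] at hlt
  exact not_fidelityGap_of_tensorRank_le hn le_rfl (hgap n _ hn hlt.le)

/-- **`FidelityThesisAt δ → 2 + δ ≤ ω(ℂ)`**: a superquadratic rank lower bound makes every
admissible exponent `≥ 2 + δ` (the argument of the route's `closes`). -/
theorem le_omega_of_fidelityThesisAt {δ : ℝ} (h : FidelityThesisAt δ) : 2 + δ ≤ omega ℂ := by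
  obtain ⟨c, hc, hrank⟩ := rank_lower_of_fidelityThesisAt h
  refine le_csInf (admissibleExponents_nonempty ℂ) ?_
  intro β hβ
  by_contra hlt
  rw [not_le] at hlt
  obtain ⟨C, hC⟩ := hβ.bound
  have hev : ∀ᶠ n : ℕ in atTop, (n : ℝ) ^ (2 + δ - β) ≤ C / c := by
    filter_upwards [hC, eventually_ge_atTop 1] with n hn hn1
    have hpos : (0 : ℝ) < n := by exact_mod_cast hn1
    rw [Real.norm_of_nonneg (Nat.cast_nonneg _),
      Real.norm_of_nonneg (Real.rpow_nonneg hpos.le _)] at hn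
    have hsq : c * (n : ℝ) ^ (2 + δ) ≤ C * (n : ℝ) ^ β := (hrank n hn1).trans hn
    rw [Real.rpow_sub hpos, div_le_iff₀ (Real.rpow_pos_of_pos hpos _), div_mul_eq_mul_div,
      le_div_iff₀ hc]
    linarith
  have ht : Tendsto (fun n : ℕ => (n : ℝ) ^ (2 + δ - β)) atTop atTop :=
    (tendsto_rpow_atTop (by linarith)).comp tendsto_natCast_atTop_atTop
  obtain ⟨n, hn1, hn2⟩ := (hev.and (ht.eventually_gt_atTop (C / c))).exists
  exact absurd hn1 (not_le.mpr hn2)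

/-- **`2 + δ < ω(ℂ) → FidelityThesisAt δ`** with `c = 1/2` (Bini's theorem `Blaser2013_thm66_holds`
+ the reduction of §1): below `n^{ω}` there is no approximate algorithm. -/
theorem fidelityThesisAt_of_lt_omega {δ : ℝ} (h : 2 + δ < omega ℂ) : FidelityThesisAt δ := by
  refine ⟨1 / 2, by norm_num, fun n r hn hr => ?_⟩
  rcases Nat.eq_zero_or_pos r with rfl | hr1
  · exact fidelityGap_rank_zero n
  -- `r ≥ 1` forces `n ≥ 2`
  have hnpow : (0 : ℝ) < (n : ℝ) ^ (2 + δ) := Real.rpow_pos_of_pos (by exact_mod_cast hn) _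
  have hn2 : 2 ≤ n := by
    by_contra hlt
    have hn1 : n = 1 := by omega
    subst hn1
    have : (1 : ℝ) ≤ r := by exact_mod_cast hr1
    rw [Nat.cast_one, Real.one_rpow] at hr
    linarith
  rw [fidelityGap_iff_lt_algBorderRank hn]
  by_contra hle
  rw [not_lt] at hle
  have hbini := Blaser2013_thm66_holds.cubic ℂ hn2 hr1 hle
  have hrlt : (r : ℝ) < (n : ℝ) ^ (2 + δ) := by linarith
  have hlog : Real.logb n r < 2 + δ :=
    (Real.logb_lt_iff_lt_rpow (by exact_mod_cast hn2) (by exact_mod_cast hr1)).2 hrlt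
  linarith

/-- **The crux implies `ω(ℂ) > 2`.** -/
theorem two_lt_omega_of_crux (h : FidelityThesis) : 2 < omega ℂ := by
  obtain ⟨δ, hδ, hAt⟩ := crux_iff.1 h
  have := le_omega_of_fidelityThesisAt hAt
  linarith

/-- **`ω(ℂ) > 2` implies the crux** (with `δ = (ω − 2)/2`, `c = 1/2`). -/
theorem crux_of_two_lt_omega (h : 2 < omega ℂ) : FidelityThesis :=
  crux_iff.2 ⟨(omega ℂ - 2) / 2, by linarith, fidelityThesisAt_of_lt_omega (by linarith)⟩

/-- **THE CRUX IS EXACTLY `ω(ℂ) > 2`** (Bini + Alder–Strassen + cone completeness, all tree theorems). -/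
theorem crux_iff_two_lt_omega : FidelityThesis ↔ 2 < omega ℂ :=
  ⟨two_lt_omega_of_crux, crux_of_two_lt_omega⟩

/-- **A DISPROOF OF THE CRUX IS A PROOF OF THE SUMMIT** (`ω(ℂ) = 2`), and conversely. -/
theorem not_crux_iff_statement : ¬ FidelityThesis ↔ _root_.MatrixMultiplication := by
  rw [crux_iff_two_lt_omega, not_lt, MatrixMultiplication_iff]
  constructor
  · intro h
    exact le_antisymm h (omega_two_le ℂ)
  · intro h
    rw [h]

/-- … equivalently `¬ crux ↔ ω(ℂ) ≤ 2`. -/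
theorem not_crux_iff_omega_le_two : ¬ FidelityThesis ↔ omega ℂ ≤ 2 := by
  rw [crux_iff_two_lt_omega, not_lt]

/-! ## §2c Registered conjectures that kill the crux

Every printed conjecture implying `ω = 2` refutes the crux via `not_crux_iff_omega_le_two`.  The
strongest one registered in the tree is the ASYMPTOTIC RANK CONJECTURE (`BCS1997_problem155_negative`,
BCS 1997 Problem 15.5 negative answer = CGLVW 2021 Question 1.7: every tensor of format `(m,n,p)` has
`R̃(t) ≤ max{m,n,p}`).  Applied to `⟨2,2,2⟩` reindexed to format `4 × 4 × 4` it gives `2^ω ≤ R̃(⟨2,2,2⟩)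
≤ 4`, i.e. `ω(ℂ) ≤ 2`. -/

/-- **The asymptotic rank conjecture implies `ω(ℂ) ≤ 2`** (tree: `rpow_omega_le_asymptoticRank_matMulTensor`,
restriction-monotonicity of `R̃`, reindexing `Fin 4 ≃ Fin 2 × Fin 2`). -/
theorem omega_le_two_of_asymptoticRankConjecture (h : BCS1997_problem155_negative ℂ) : omega ℂ ≤ 2 := by
  set e : Fin 4 ≃ Fin 2 × Fin 2 := (finCongr (show 4 = 2 * 2 by norm_num)).trans finProdFinEquiv.symm
    with he
  set t' : Fin 4 → Fin 4 → Fin 4 → ℂ := fun a b c => matMulTensor ℂ 2 2 2 (e a) (e b) (e c) with ht'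
  have hres : TensorRestrictsTo t' (matMulTensor ℂ 2 2 2) := tensorRestrictsTo_of_reindex _ e e e
  have h1 : asymptoticRank (matMulTensor ℂ 2 2 2) ≤ asymptoticRank t' :=
    asymptoticRank_le_of_polyDegeneratesTo hres.polyDegeneratesTo
  have h2 : asymptoticRank t' ≤ 4 := by simpa using h 4 4 4 t'
  have h3 : (2 : ℝ) ^ omega ℂ ≤ asymptoticRank (matMulTensor ℂ 2 2 2) := by
    simpa using rpow_omega_le_asymptoticRank_matMulTensor ℂ 2
  have h4 : (2 : ℝ) ^ omega ℂ ≤ (2 : ℝ) ^ (2 : ℝ) := by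
    rw [Real.rpow_two]; norm_num; linarith
  exact (Real.rpow_le_rpow_left_iff (by norm_num : (1 : ℝ) < 2)).1 h4

/-- **The crux contradicts the asymptotic rank conjecture**: `ARC → ¬ FidelityThesis`. -/
theorem crux_false_of_asymptoticRankConjecture (h : BCS1997_problem155_negative ℂ) : ¬ FidelityThesis :=
  not_crux_iff_omega_le_two.2 (omega_le_two_of_asymptoticRankConjecture h)

/-! ## §2b The exponent window: which `δ` can witness the crux -/

/-- An exponent above `ω(ℂ) − 2` cannot witness the crux. -/
theorem not_fidelityThesisAt_of_omega_lt {δ : ℝ} (h : omega ℂ < 2 + δ) : ¬ FidelityThesisAt δ :=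
  fun hAt => absurd (le_omega_of_fidelityThesisAt hAt) (not_le.2 h)

/-- **Refuted strengthening (tree bound `ω ≤ 2.37295`, Le Gall 2014 / CW⁴, sorry-free in the tree):
no `δ > 0.37295` witnesses the crux** — any proof must produce its gap below `r ≈ n^{2.373}`. -/
theorem not_fidelityThesisAt_of_gt {δ : ℝ} (h : 0.37295 < δ) : ¬ FidelityThesisAt δ :=
  not_fidelityThesisAt_of_omega_lt (by have := LeGall2014_cw4_omega_le ℂ; linarith)

/-- In particular the "cubic-scale" version `δ = 1` is false … -/
theorem not_fidelityThesisAt_one : ¬ FidelityThesisAt 1 :=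
  not_fidelityThesisAt_of_gt (by norm_num)

/-- … and so is `δ = 1/2`. -/
theorem not_fidelityThesisAt_half : ¬ FidelityThesisAt (1 / 2) :=
  not_fidelityThesisAt_of_gt (by norm_num)

/-- **Transfer from ONE effective algorithm** (the per-datum version of the window): a single bound
`R(⟨m,m,m⟩) ≤ q` (`m ≥ 2`) caps every witness exponent, `2 + δ ≤ log_m q` — Strassen `(2,7)`:
`δ ≤ 0.807`; Laderman `(3,23)`: `δ ≤ 0.854`; DPS `(4,48)`: `δ ≤ 0.792` — all dominated by the laser-method
value `0.37295` above, which is why finite scheme-hunting cannot move this crux's window. -/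
theorem delta_le_of_rank_le {δ : ℝ} (h : FidelityThesisAt δ) {m q : ℕ} (hm : 2 ≤ m)
    (hq : tensorRank (matMulTensor ℂ m m m) ≤ q) : 2 + δ ≤ Real.logb m q := by
  have h1 := le_omega_of_fidelityThesisAt h
  have h2 := omega_le_logb_tensorRank_matMulTensor ℂ hm
  have hRpos : (0 : ℝ) < tensorRank (matMulTensor ℂ m m m) := tensorRank_matMulTensor_pos ℂ hm
  have h3 : Real.logb m (tensorRank (matMulTensor ℂ m m m)) ≤ Real.logb m q :=
    Real.logb_le_logb_of_le (by exact_mod_cast hm) hRpos (by exact_mod_cast hq)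
  linarith

/-- … and from ONE approximate algorithm `R̲(⟨m,m,m⟩) ≤ q` (Bini): `2 + δ ≤ log_m q` — Smirnov
`(3,20)`: `δ ≤ 0.727`. -/
theorem delta_le_of_algBorderRank_le {δ : ℝ} (h : FidelityThesisAt δ) {m q : ℕ} (hm : 2 ≤ m)
    (hq1 : 1 ≤ q) (hq : algBorderRank (matMulTensor ℂ m m m) ≤ q) : 2 + δ ≤ Real.logb m q := by
  have h1 := le_omega_of_fidelityThesisAt h
  have h2 := Blaser2013_thm66_holds.cubic ℂ hm hq1 hq
  linarith

/-- The family is antitone in the exponent. -/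
theorem fidelityThesisAt_antitone {δ δ' : ℝ} (h : δ ≤ δ') :
    FidelityThesisAt δ' → FidelityThesisAt δ := by
  rintro ⟨c, hc, hgap⟩
  refine ⟨c, hc, fun n r hn hr => hgap n r hn (hr.trans ?_)⟩
  have hn1 : (1 : ℝ) ≤ n := by exact_mod_cast hn
  exact mul_le_mul_of_nonneg_left (Real.rpow_le_rpow_of_exponent_le hn1 (by linarith)) hc.le

/-- So the crux is `∃ δ > 0` over a DOWN-SET of exponents whose supremum is `ω(ℂ) − 2 ∈ [0, 0.37295]`:
`FidelityThesisAt δ` for all `δ < ω − 2`, `¬ FidelityThesisAt δ` for all `δ > ω − 2`. -/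
theorem fidelityThesisAt_iff_of_ne {δ : ℝ} (hne : 2 + δ ≠ omega ℂ) :
    FidelityThesisAt δ ↔ 2 + δ < omega ℂ :=
  ⟨fun h => lt_of_le_of_ne (le_omega_of_fidelityThesisAt h) hne, fidelityThesisAt_of_lt_omega⟩

/-! ## §2d What any proof must deliver: superquadratic rungs, beyond every `A·n²`

A witness `(δ, c)` certifies `⌊c·n^{2+δ}⌋ < R̲(⟨n,n,n⟩)` for EVERY `n ≥ 1` (§1), hence border-rank
lower bounds exceeding `A·n²` for every `A` and all large `n` — in particular beyond the cactus cap
`6n² − 4` of every linear rank method (`Literature.Barriers.MatrixMultiplication.LinearRankMethodBarrier`,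
proved in the tree) and beyond everything in print (`2n² − n`, `2n² − ⌈log₂ n⌉ − 1`).  So the crux needs
infinitely many rungs none of which any catalogued technique certifies; the tree certifies today
`R̲(⟨2,2,2⟩) = 7`, `16 ≤ R̲(⟨3,3,3⟩)`, `3n²/2 ≤ R̲(⟨n,n,n⟩)`. -/

/-- Eventually `A·n² + 1 ≤ c·n^{2+δ}` (`δ, c > 0`). -/
theorem eventually_quadratic_le_curve {δ c : ℝ} (hδ : 0 < δ) (hc : 0 < c) (A : ℝ) :
    ∀ᶠ n : ℕ in atTop, A * (n : ℝ) ^ 2 + 1 ≤ c * (n : ℝ) ^ (2 + δ) := by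
  have ht : Tendsto (fun n : ℕ => (n : ℝ) ^ δ) atTop atTop :=
    (tendsto_rpow_atTop hδ).comp tendsto_natCast_atTop_atTop
  filter_upwards [ht.eventually_ge_atTop ((|A| + 1) / c), eventually_ge_atTop 1] with n hn hn1
  have hn1' : (1 : ℝ) ≤ n := by exact_mod_cast hn1
  have hpos : (0 : ℝ) < n := by linarith
  have hpow : (n : ℝ) ^ (2 + δ) = (n : ℝ) ^ 2 * (n : ℝ) ^ δ := by
    rw [Real.rpow_add hpos, Real.rpow_two]
  rw [hpow]
  have h1 : |A| + 1 ≤ c * (n : ℝ) ^ δ := by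
    rw [div_le_iff₀ hc] at hn
    linarith
  have key : (n : ℝ) ^ 2 * (|A| + 1) ≤ (n : ℝ) ^ 2 * (c * (n : ℝ) ^ δ) :=
    mul_le_mul_of_nonneg_left h1 (by positivity)
  have hA : A ≤ |A| := le_abs_self A
  have hn2 : (1 : ℝ) ≤ (n : ℝ) ^ 2 := by nlinarith
  nlinarith [key, hA, hn2, sq_nonneg (n : ℝ), abs_nonneg A]

/-- **A witness at exponent `δ > 0` forces `R̲(⟨n,n,n⟩) > A·n²` for every `A`, eventually in `n`** —
superquadratic border-rank lower bounds all along, beyond the `6n² − 4` cactus cap of linear rank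
methods and beyond every bound in print. -/
theorem eventually_lt_algBorderRank_of_fidelityThesisAt {δ : ℝ} (hδ : 0 < δ)
    (h : FidelityThesisAt δ) (A : ℝ) :
    ∀ᶠ n : ℕ in atTop, A * (n : ℝ) ^ 2 < (algBorderRank (matMulTensor ℂ n n n) : ℝ) := by
  obtain ⟨c, hc, hgap⟩ := h
  filter_upwards [eventually_quadratic_le_curve hδ hc A, eventually_ge_atTop 1] with n hn hn1
  set r : ℕ := ⌊c * (n : ℝ) ^ (2 + δ)⌋₊ with hr
  have hrle : (r : ℝ) ≤ c * (n : ℝ) ^ (2 + δ) := Nat.floor_le (by positivity)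
  have hgap' := hgap n r hn1 hrle
  rw [fidelityGap_iff_lt_algBorderRank hn1] at hgap'
  have hfloor : c * (n : ℝ) ^ (2 + δ) < (r : ℝ) + 1 := Nat.lt_floor_add_one _
  have hbR : (r : ℝ) + 1 ≤ (algBorderRank (matMulTensor ℂ n n n) : ℝ) := by
    exact_mod_cast Nat.succ_le_of_lt hgap'
  linarith

/-- In particular **the crux implies `R̲(⟨n,n,n⟩) > 6n² − 4` (the cactus cap) for all large `n`** —
rungs that no linear rank method certifies (`LinearRankMethodBarrier.matMul`). -/
theorem eventually_cactusCap_lt_algBorderRank_of_crux (h : FidelityThesis) :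
    ∀ᶠ n : ℕ in atTop, (6 * (n : ℝ) ^ 2 - 4) < (algBorderRank (matMulTensor ℂ n n n) : ℝ) := by
  obtain ⟨δ, hδ, hAt⟩ := crux_iff.1 h
  filter_upwards [eventually_lt_algBorderRank_of_fidelityThesisAt hδ hAt 6] with n hn
  linarith

/-! ## §3 Load-bearing analysis -/

/-- (H_rank) The crux with the hypothesis `tensorRank S ≤ r` DROPPED. -/
def CruxWithoutRankBound : Prop :=
  ∃ δ : ℝ, 0 < δ ∧ ∃ c : ℝ, 0 < c ∧ ∀ n r : ℕ, 1 ≤ n → (r : ℝ) ≤ c * (n : ℝ) ^ (2 + δ) →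
    ∃ ε : ℝ, 0 < ε ∧ ∀ S : Tn n,
      ‖∑ a, ∑ b, ∑ c, S a b c * matMulTensor ℂ n n n a b c‖ ^ 2 ≤
        (1 - ε) * (n : ℝ) ^ 3 * ∑ a, ∑ b, ∑ c, ‖S a b c‖ ^ 2

/-- **Any proof must use the rank bound**: without it, `(n, r) = (1, 0)` and `S = ⟨1,1,1⟩` refute. -/
theorem crux_false_without_rankBound : ¬ CruxWithoutRankBound := by
  rintro ⟨δ, hδ, c, hc, h⟩
  obtain ⟨ε, hε, hS⟩ := h 1 0 le_rfl (by simp only [Nat.cast_zero, Nat.cast_one, Real.one_rpow]; linarith)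
  exact not_gap_self le_rfl hε (hS (matMulTensor ℂ 1 1 1))

/-- (H_growth) The crux with the growth constraint `r ≤ c·n^{2+δ}` DROPPED (then `δ, c` are idle). -/
def CruxWithoutGrowthBound : Prop :=
  ∀ n r : ℕ, 1 ≤ n → FidelityGap n r

/-- **Any proof must use the growth constraint**: `(n, r) = (1, 1)`, `S = ⟨1,1,1⟩` (rank `≤ 1`). -/
theorem crux_false_without_growthBound : ¬ CruxWithoutGrowthBound :=
  fun h => not_fidelityGap_cube (n := 1) (r := 1) le_rfl (by norm_num) (h 1 1 le_rfl)

/-- (H_c) **The constant must be `< 1`**: for every `δ`, `c ≥ 1` admits `(n, r) = (1, 1)` and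
`S = ⟨1,1,1⟩` refutes.  (So the crux quantifies over `c ∈ (0, 1)` only; cf. `c = 1/2` in §2.) -/
theorem not_fidelityThesisAt_with_one_le {δ c : ℝ} (hc : 1 ≤ c)
    (h : ∀ n r : ℕ, 1 ≤ n → (r : ℝ) ≤ c * (n : ℝ) ^ (2 + δ) → FidelityGap n r) : False := by
  have h11 := h 1 1 le_rfl (by simp only [Nat.cast_one, Real.one_rpow]; linarith)
  exact not_fidelityGap_cube (n := 1) (r := 1) le_rfl (by norm_num) h11

/-- More generally the constant is capped by every single rank value: `c ≤ R(⟨n,n,n⟩)/n^{2+δ}`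
fails the gap at `r = R(⟨n,n,n⟩)`; e.g. with Strassen-type schemes in the tree this caps `c` further.
Stated: a witness `(δ, c)` has `c·n^{2+δ} < R(⟨n,n,n⟩) + 1` for all `n ≥ 1`. -/
theorem const_lt_of_witness {δ c : ℝ}
    (h : ∀ n r : ℕ, 1 ≤ n → (r : ℝ) ≤ c * (n : ℝ) ^ (2 + δ) → FidelityGap n r) {n : ℕ} (hn : 1 ≤ n) :
    c * (n : ℝ) ^ (2 + δ) < (tensorRank (matMulTensor ℂ n n n) : ℝ) + 1 := by
  by_contra hle
  rw [not_lt] at hle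
  have := h n (tensorRank (matMulTensor ℂ n n n)) hn (by linarith)
  exact not_fidelityGap_of_tensorRank_le hn le_rfl this

/-- (H_n) The crux with `1 ≤ n` DROPPED. -/
def CruxWithoutOneLeN : Prop :=
  ∃ δ : ℝ, 0 < δ ∧ ∃ c : ℝ, 0 < c ∧ ∀ n r : ℕ, (r : ℝ) ≤ c * (n : ℝ) ^ (2 + δ) → FidelityGap n r

/-- **`1 ≤ n` is NOT load-bearing**: the `n = 0` instance is vacuous, so dropping it changes nothing
(information for the prover: the hypothesis may be ignored). -/
theorem cruxWithoutOneLeN_iff_crux : CruxWithoutOneLeN ↔ FidelityThesis := by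
  rw [crux_iff]
  constructor
  · rintro ⟨δ, hδ, c, hc, h⟩
    exact ⟨δ, hδ, c, hc, fun n r _ hr => h n r hr⟩
  · rintro ⟨δ, hδ, c, hc, h⟩
    refine ⟨δ, hδ, c, hc, fun n r hr => ?_⟩
    rcases Nat.eq_zero_or_pos n with rfl | hn
    · exact fidelityGap_zero_left r
    · exact h n r hn hr

/-- (H_δ) **`0 < δ` carries ALL the content**: at `δ = 0` the statement is a THEOREM (flattening,
`n² ≤ R̲(⟨n,n,n⟩)`, tree lemma `mul_le_algBorderRank_matMulTensor`; `c = 1/2`). -/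
theorem fidelityThesisAt_zero : FidelityThesisAt 0 := by
  refine ⟨1 / 2, by norm_num, fun n r hn hr => ?_⟩
  rw [fidelityGap_iff_lt_algBorderRank hn]
  haveI : NeZero n := ⟨by omega⟩
  have hflat : n * n ≤ algBorderRank (matMulTensor ℂ n n n) :=
    mul_le_algBorderRank_matMulTensor ℂ n n n
  have hn1 : (1 : ℝ) ≤ n := by exact_mod_cast hn
  have hr' : (r : ℝ) < (n * n : ℕ) := by
    rw [add_zero, show ((2 : ℝ)) = ((2 : ℕ) : ℝ) by norm_num, Real.rpow_natCast] at hr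
    push_cast
    nlinarith
  exact_mod_cast hr'.trans_le (by exact_mod_cast hflat : ((n * n : ℕ) : ℝ) ≤ algBorderRank _)

/-- … and so is every `δ ≤ 0`. -/
theorem fidelityThesisAt_of_nonpos {δ : ℝ} (h : δ ≤ 0) : FidelityThesisAt δ :=
  fidelityThesisAt_antitone h fidelityThesisAt_zero

/-! ## §4 Tightness of `ε` at a rung: the partial standard algorithm

`r` of the `n³` unit triads of `⟨n,n,n⟩` form a rank-`≤ r` tensor of fidelity `r/n³`, so every
admissible gap constant at `(n, r)` has `ε ≤ 1 − r/n³` (`M(n,r) ≥ r`, the trivial lower frame of the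
profile; the true `M(n,r)` is super-additive beyond it, e.g. `M(2,3) > 3`, support item RankThreeDefect). -/

/-- The support of `⟨n,n,n⟩`: the image of `(i,j,k) ↦ ((i,k),(i,j),(j,k))`. -/
def unitIndex (n : ℕ) (p : Fin n × Fin n × Fin n) :
    (Fin n × Fin n) × (Fin n × Fin n) × (Fin n × Fin n) :=
  ((p.1, p.2.2), (p.1, p.2.1), (p.2.1, p.2.2))

theorem unitIndex_injective (n : ℕ) : Function.Injective (unitIndex n) := by
  rintro ⟨i, j, k⟩ ⟨i', j', k'⟩ h
  simp only [unitIndex, Prod.mk.injEq] at h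
  obtain ⟨⟨rfl, rfl⟩, ⟨-, rfl⟩, -⟩ := h
  rfl

/-- `⟨n,n,n⟩ = 1` on its support. -/
theorem matMulTensor_unitIndex (K : Type) [CommRing K] (n : ℕ) (p : Fin n × Fin n × Fin n) :
    matMulTensor K n n n (unitIndex n p).1 (unitIndex n p).2.1 (unitIndex n p).2.2 = 1 := by
  simp [matMulTensor, unitIndex]

/-- The support as a `Finset`; it has `n³` elements. -/
def support (n : ℕ) : Finset ((Fin n × Fin n) × (Fin n × Fin n) × (Fin n × Fin n)) :=
  Finset.univ.map ⟨unitIndex n, unitIndex_injective n⟩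

theorem card_support (n : ℕ) : (support n).card = n ^ 3 := by
  simp [support, Fintype.card_prod, Fintype.card_fin, pow_succ, mul_assoc]

theorem matMulTensor_of_mem_support {n : ℕ} {x : (Fin n × Fin n) × (Fin n × Fin n) × (Fin n × Fin n)}
    (hx : x ∈ support n) : matMulTensor ℂ n n n x.1 x.2.1 x.2.2 = 1 := by
  simp only [support, Finset.mem_map, Finset.mem_univ, Function.Embedding.coeFn_mk, true_and] at hx
  obtain ⟨p, rfl⟩ := hx
  exact matMulTensor_unitIndex ℂ n p

/-- The indicator tensor of a set `B` of index triples. -/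
def indicatorTensor {n : ℕ} (B : Finset ((Fin n × Fin n) × (Fin n × Fin n) × (Fin n × Fin n))) :
    Tn n := fun a b c => if (a, b, c) ∈ B then 1 else 0

/-- An elementary triad `e_i ⊗ e_j ⊗ e_k` is the indicator of one index triple. -/
theorem triad_single_apply {n : ℕ} (x : (Fin n × Fin n) × (Fin n × Fin n) × (Fin n × Fin n))
    (a b c : Fin n × Fin n) :
    triad (Pi.single x.1 (1 : ℂ)) (Pi.single x.2.1 (1 : ℂ)) (Pi.single x.2.2 (1 : ℂ)) a b c =
      if (a, b, c) = x then 1 else 0 := by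
  obtain ⟨i, j, k⟩ := x
  simp only [triad_apply, Pi.single_apply, Prod.mk.injEq]
  split_ifs <;> simp_all

/-- The indicator tensor of `B` is the sum of the `|B|` elementary triads it contains … -/
theorem indicatorTensor_eq_sum {n : ℕ}
    (B : Finset ((Fin n × Fin n) × (Fin n × Fin n) × (Fin n × Fin n))) :
    indicatorTensor B = ∑ s : B, triad (Pi.single s.1.1 (1 : ℂ)) (Pi.single s.1.2.1 (1 : ℂ))
      (Pi.single s.1.2.2 (1 : ℂ)) := by
  funext a b c
  rw [Finset.sum_apply, Finset.sum_apply, Finset.sum_apply]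
  simp_rw [triad_single_apply]
  rw [Finset.sum_coe_sort B (fun x => if (a, b, c) = x then (1 : ℂ) else 0), Finset.sum_ite_eq]
  rfl

/-- … so its rank is at most `|B|`. -/
theorem tensorRank_indicatorTensor_le {n : ℕ}
    (B : Finset ((Fin n × Fin n) × (Fin n × Fin n) × (Fin n × Fin n))) :
    tensorRank (indicatorTensor B) ≤ B.card := by
  simpa using tensorRank_le_card_of_eq_sum _ _ _ (indicatorTensor_eq_sum B)

/-- Triple sums of a function of the triple are sums over the product type. -/
theorem sum_sum_sum_eq {n : ℕ} {M : Type} [AddCommMonoid M]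
    (f : (Fin n × Fin n) × (Fin n × Fin n) × (Fin n × Fin n) → M) :
    (∑ a : Fin n × Fin n, ∑ b : Fin n × Fin n, ∑ c : Fin n × Fin n, f (a, b, c)) = ∑ x, f x := by
  simp only [Fintype.sum_prod_type]

/-- `‖1_B‖² = |B|`. -/
theorem normSq_indicatorTensor {n : ℕ}
    (B : Finset ((Fin n × Fin n) × (Fin n × Fin n) × (Fin n × Fin n))) :
    (∑ a, ∑ b, ∑ c, ‖indicatorTensor B a b c‖ ^ 2) = (B.card : ℝ) := by
  have h : ∀ a b c, ‖indicatorTensor B a b c‖ ^ 2 = if (a, b, c) ∈ B then (1 : ℝ) else 0 := by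
    intro a b c
    unfold indicatorTensor
    split_ifs <;> simp
  simp_rw [h]
  rw [sum_sum_sum_eq (fun x => if x ∈ B then (1 : ℝ) else 0), Finset.sum_ite_mem, Finset.univ_inter,
    Finset.sum_const, nsmul_eq_mul, mul_one]

/-- On a subset of the support, `⟨1_B, ⟨n,n,n⟩⟩ = |B|`. -/
theorem overlap_indicatorTensor {n : ℕ}
    {B : Finset ((Fin n × Fin n) × (Fin n × Fin n) × (Fin n × Fin n))} (hB : B ⊆ support n) :
    (∑ a, ∑ b, ∑ c, indicatorTensor B a b c * matMulTensor ℂ n n n a b c) = (B.card : ℂ) := by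
  have h : ∀ a b c, indicatorTensor B a b c * matMulTensor ℂ n n n a b c =
      if (a, b, c) ∈ B then (1 : ℂ) else 0 := by
    intro a b c
    unfold indicatorTensor
    split_ifs with hmem
    · rw [one_mul]
      exact matMulTensor_of_mem_support (hB hmem)
    · rw [zero_mul]
  simp_rw [h]
  rw [sum_sum_sum_eq (fun x => if x ∈ B then (1 : ℂ) else 0), Finset.sum_ite_mem, Finset.univ_inter,
    Finset.sum_const, nsmul_eq_mul, mul_one]

/-- **`M(n,r) ≥ r`**: for `r ≤ n³` there is a rank-`≤ r` tensor with `|⟨S,⟨n,n,n⟩⟩|² = r·‖S‖²`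
(and `‖S‖² = r`). -/
theorem exists_rank_le_overlap_eq {n r : ℕ} (hr : r ≤ n ^ 3) :
    ∃ S : Tn n, tensorRank S ≤ r ∧
      (∑ a, ∑ b, ∑ c, S a b c * matMulTensor ℂ n n n a b c) = (r : ℂ) ∧
      (∑ a, ∑ b, ∑ c, ‖S a b c‖ ^ 2) = (r : ℝ) := by
  obtain ⟨B, hB, hcard⟩ := Finset.exists_subset_card_eq (s := support n) (n := r)
    (by rw [card_support]; exact hr)
  refine ⟨indicatorTensor B, hcard ▸ tensorRank_indicatorTensor_le B, ?_, ?_⟩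
  · rw [overlap_indicatorTensor hB, hcard]
  · rw [normSq_indicatorTensor, hcard]

/-- **Tightness**: `GapAt n r ε` with `1 ≤ r ≤ n³` forces `ε ≤ 1 − r/n³`. -/
theorem gapAt_eps_le {n r : ℕ} {ε : ℝ} (hn : 1 ≤ n) (hr1 : 1 ≤ r) (hr : r ≤ n ^ 3)
    (h : GapAt n r ε) : ε ≤ 1 - r / (n : ℝ) ^ 3 := by
  obtain ⟨S, hS, hov, hnorm⟩ := exists_rank_le_overlap_eq hr
  have key := h S hS
  rw [hov, hnorm, Complex.norm_natCast] at key
  have hn3 : (0 : ℝ) < (n : ℝ) ^ 3 := by positivity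
  have hr0 : (0 : ℝ) < r := by exact_mod_cast hr1
  have hdiv : (r : ℝ) / (n : ℝ) ^ 3 ≤ 1 - ε := by
    rw [div_le_iff₀ hn3]
    nlinarith
  linarith

/-- In particular no gap constant at any rung `(n, r)`, `r ≥ 1`, exceeds `1 − 1/n³`. -/
theorem gapAt_eps_le_one_sub {n r : ℕ} {ε : ℝ} (hn : 1 ≤ n) (hr1 : 1 ≤ r) (h : GapAt n r ε) :
    ε ≤ 1 - 1 / (n : ℝ) ^ 3 := by
  have hmono : GapAt n 1 ε := fun S hS => h S (hS.trans hr1)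
  have h1 : 1 ≤ n ^ 3 := Nat.one_le_pow _ _ hn
  simpa using gapAt_eps_le hn le_rfl h1 hmono

/-! ## §5 WHY IT RESISTS — and what the attacks buy (read me, provers)

* **No kill exists short of the summit.** `not_crux_iff_statement` (kernel-checked, axioms
  `propext/Classical.choice/Quot.sound`): `¬ FidelityThesis ↔ ω(ℂ) = 2`.  Every cdisprove weapon —
  small models, degenerate `n`, junk `S`, limiting regimes — is absorbed by the `∃ δ ∃ c` prefix: a
  counterexample at one `(n, r)` only lowers the admissible `c` (`const_lt_of_witness`) or `δ`
  (`not_fidelityThesisAt_of_omega_lt`), never kills the `∃`.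
* **What IS refuted** (natural strengthenings): every fixed exponent `δ > ω(ℂ) − 2`, today every
  `δ > 0.37295` (`not_fidelityThesisAt_of_gt`; the tree's best upper bound is Le Gall's CW⁴ value —
  the records 2.3716/2.3713 rest on an unformalised certificate layer, see
  `Literature/…/BigCwFourthCertificate.lean`); every `c ≥ 1` (`not_fidelityThesisAt_with_one_le`);
  the rank-free and growth-free mutilations (§3).  Any proof of the crux must therefore exhibit its
  gaps in the window `n² < r ≤ c·n^{2+δ}` with `δ ≤ 0.37295`, `c < 1`, i.e. strictly between the
  flattening regime (where `fidelityThesisAt_zero` already lives, `r < n²`) and `n^{2.373}`.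
* **Per-rung currency.** By §1 a gap at `(n, r)` is the border-rank statement `r < R̲(⟨n,n,n⟩)`; the
  tree knows `R̲(⟨2,2,2⟩) = 7`, `16 ≤ R̲(⟨3,3,3⟩) ≤ 20`, `R̲ ≥ 3n²/2` (`n ≥ 2`,
  `three_mul_sq_le_two_mul_algBorderRank_matMulTensor`) and `R̲ ≥ 2n² − n` is in print
  (Landsberg–Ottaviani 2015) — all QUADRATIC, so no rung with `r ≥ 2n²` is certified for any `n ≥ 4`,
  and the crux needs infinitely many superquadratic rungs.  Conversely a disproof needs
  `R̲(⟨n,n,n⟩) ≤ c·n^{2+δ}` for EVERY `(δ, c)` at some `n` — i.e. `ω = 2`.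
* **Tightness** (§4): at each rung `ε(n,r) ≤ 1 − r/n³`; the interesting defect `n³ − M(n,r)` versus
  `R̲ − r` is the business of the cruxes LinearDefectLaw / SevenEighthsLaw / DiagonalPowerDecay, whose
  standing disproofs (`Cruxes/<Crux>/Disproof.lean`) hold the numerics (M(2,r) profile, M(3,17) ≥ 21
  border-tight, φ(n) estimates).
* **Open variants (neither killed nor reduced here; questions for the planner).** (i) UNIFORM ε:
  `∃ δ c ε > 0, ∀ n ≥ 1, ∀ r ≤ c·n^{2+δ}, GapAt n r ε` — implies the crux; not refutable by any family in
  hand (partial standard algorithm: fidelity `r/n³ = c·n^{δ−1} → 0`; `p` diagonal blocks `⟨m,m,m⟩` with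
  `p·R(⟨m⟩) ≤ c(pm)^{2+δ}`: fidelity `1/p² → 0` since `p → ∞` is forced when `δ < log_m R(⟨m⟩) − 2`);
  plausibly TRUE whenever the crux is (fidelity along `r ≪ n^ω` should decay, cf. crux
  DiagonalPowerDecay), but no reduction either way is known to this seat.  (ii) EXPLICIT ε(n,r): any
  `ε(n,r) ≥ n^{−O(1)}` version is equally open.  (iii) Replacing border rank by rank in the conclusion
  changes nothing (closure, §1).
* **Dead ends logged (cycle 1):** n = 0/1 degeneracies (absorbed: `cruxWithoutOneLeN_iff_crux`,
  `c < 1`); r = 0 rung (free, `fidelityGap_rank_zero`); r ≥ n³ (no gap, `not_fidelityGap_cube`, but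
  excluded by `c < 1`); conjugation / bilinear-vs-sesquilinear pairing (harmless, `norm_overlap_conj`);
  junk `tensorRank` values (format is finite, `sInf` attained); `Real.rpow` at `n = 0`
  (`0^{2+δ} = 0`, vacuous).  Nothing bites.
-/

end Summit.MatrixMultiplication.MatrixMultiplication.Cruxes.FidelityThesis.Disproof
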